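import Summits.NavierStokesRegularity.NavierStokesRegularity.Theorems.CoriolisHeadTypeIRatePressureKernel
import HarnessLib

/-!
# CoriolisHeadTypeIRateDyadicPressureKernel — crux `NoCoRotatingCore` (stmt-NavierStokesRegularity-22676), line
# `far_field_constancy` v2 (skeleton 15c9a82ad206abb9), stub K1c `stub_typeIRate`:
# third door, pressure half 1/2 — ball integrals of `|ΔP|` under a DYADIC modulus

The landed pressure-gradient rate (`CoriolisHeadTypeIRatePressureRate`) works under a global power bound
`|ΔP| ≤ K₂(1+r)^{−q}`.  For the third door to K1c («K1a with a square-summable dyadic modulus ⇒ K1c», memo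
K1C-REDUCTION-v4) the bound is scale-dependent: `|ΔP(w)| ≤ θ_i/‖w‖²` on `‖w‖ ≥ 2^i`.  This file supplies the two
ball-integral estimates the centred telescoping needs in that currency —
* `setIntegral_abs_laplacian_translate_le`: `∫_{|z|≤r} |ΔP(y+z)| dz ≤ ∫_{|w| ≤ r+‖y‖} |ΔP(w)| dw`;
* `setIntegral_abs_laplacian_two_pow_le`: `∫_{|w|≤2^K} |ΔP| ≤ ∫_{|w|≤1} |ΔP| + 8|B₁| Σ_{i<K} θ_i 2^i` (dyadic shells);
* `abs_shellStep_le_dyadic_small`: the small-scale shell step under a far-field bound `|ΔP(w)| ≤ τ/‖w‖²`, `‖w‖ ≥ ‖y‖/2`;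
and two finite-sum inequalities (`sum_range_half_pow_le`, `sum_range_weighted_le_two_mul`) for the summation.
Elementary; nothing here proves K1c, `NoCoRotatingCore` or NS regularity.

References: line card `Cruxes/NoCoRotatingCore/Lines/far_field_constancy.md` (K1c block); D. Gilbarg, N. S. Trudinger
(2001) §4.2 [GilbargTrudinger2001].
-/

noncomputable section

open MeasureTheory Set Function Filter Topology Metric InnerProductSpace Real
open scoped RealInnerProductSpace BigOperators Laplacian ContDiff

-- the summit and its single sub-problem share the name (CONVENTIONS §1), as in every Theorems file
set_option linter.dupNamespace false

namespace Summit.NavierStokesRegularity.NavierStokesRegularity.Theorems.CoriolisHead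

namespace TypeIRate

open Literature.Analysis.FluidPDE

/-! ## §1 Ball integrals of `|ΔP|` -/

/-- Translation: `∫_{|z|≤r} |ΔP(y+z)| dz ≤ ∫_{|w|≤r+‖y‖} |ΔP(w)| dw` (the ball around `y` sits inside the big
ball around `0`; the integrand is nonnegative). [folklore] -/
theorem setIntegral_abs_laplacian_translate_le {P : EuclideanSpace ℝ (Fin 3) → ℝ} (hP : ContDiff ℝ 2 P)
    (y : EuclideanSpace ℝ (Fin 3)) (r : ℝ) :
    ∫ z in closedBall (0 : EuclideanSpace ℝ (Fin 3)) r, |(Δ P) (y + z)| ≤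
      ∫ w in closedBall (0 : EuclideanSpace ℝ (Fin 3)) (r + ‖y‖), |(Δ P) w| := by
  have hΔc : Continuous fun w : EuclideanSpace ℝ (Fin 3) => |(Δ P) w| :=
    (Literature.Analysis.FluidPDE.continuous_laplacian hP).abs
  have hΔcy : Continuous fun z : EuclideanSpace ℝ (Fin 3) => |(Δ P) (y + z)| :=
    hΔc.comp (continuous_const.add continuous_id)
  set g : EuclideanSpace ℝ (Fin 3) → ℝ :=
    (closedBall (0 : EuclideanSpace ℝ (Fin 3)) (r + ‖y‖)).indicator fun w => |(Δ P) w| with hg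
  have hpt : (fun z => (closedBall (0 : EuclideanSpace ℝ (Fin 3)) r).indicator (fun z => |(Δ P) (y + z)|) z) ≤
      fun z => g (y + z) := by
    intro z
    by_cases hz : z ∈ closedBall (0 : EuclideanSpace ℝ (Fin 3)) r
    · have hyz : y + z ∈ closedBall (0 : EuclideanSpace ℝ (Fin 3)) (r + ‖y‖) := by
        rw [mem_closedBall_zero_iff] at hz ⊢
        calc ‖y + z‖ ≤ ‖y‖ + ‖z‖ := norm_add_le _ _
          _ ≤ r + ‖y‖ := by linarith
      simp only [Set.indicator_of_mem hz, hg, Set.indicator_of_mem hyz, le_refl]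
    · simp only [Set.indicator_of_notMem hz, hg]
      exact Set.indicator_nonneg (fun _ _ => abs_nonneg _) _
  have hint1 : Integrable fun z => (closedBall (0 : EuclideanSpace ℝ (Fin 3)) r).indicator
      (fun z => |(Δ P) (y + z)|) z :=
    (hΔcy.continuousOn.integrableOn_compact (isCompact_closedBall _ _)).integrable_indicator
      measurableSet_closedBall
  have hgi : Integrable g :=
    (hΔc.continuousOn.integrableOn_compact (isCompact_closedBall _ _)).integrable_indicator
      measurableSet_closedBall
  have hint2 : Integrable fun z => g (y + z) := hgi.comp_add_left y
  calc ∫ z in closedBall (0 : EuclideanSpace ℝ (Fin 3)) r, |(Δ P) (y + z)|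
      = ∫ z, (closedBall (0 : EuclideanSpace ℝ (Fin 3)) r).indicator (fun z => |(Δ P) (y + z)|) z :=
        (integral_indicator measurableSet_closedBall).symm
    _ ≤ ∫ z, g (y + z) := integral_mono hint1 hint2 hpt
    _ = ∫ w, g w := integral_add_left_eq_self g y
    _ = ∫ w in closedBall (0 : EuclideanSpace ℝ (Fin 3)) (r + ‖y‖), |(Δ P) w| := by
        rw [hg, integral_indicator measurableSet_closedBall]

/-- Monotonicity in the radius: `∫_{|w|≤r} |ΔP| ≤ ∫_{|w|≤r'} |ΔP|` for `r ≤ r'`. [folklore] -/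
theorem setIntegral_abs_laplacian_mono {P : EuclideanSpace ℝ (Fin 3) → ℝ} (hP : ContDiff ℝ 2 P)
    {r r' : ℝ} (hrr' : r ≤ r') :
    ∫ w in closedBall (0 : EuclideanSpace ℝ (Fin 3)) r, |(Δ P) w| ≤
      ∫ w in closedBall (0 : EuclideanSpace ℝ (Fin 3)) r', |(Δ P) w| := by
  have hΔc : Continuous fun w : EuclideanSpace ℝ (Fin 3) => |(Δ P) w| :=
    (Literature.Analysis.FluidPDE.continuous_laplacian hP).abs
  exact setIntegral_mono_set (hΔc.continuousOn.integrableOn_compact (isCompact_closedBall _ _))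
    (Eventually.of_forall fun _ => abs_nonneg _) (Eventually.of_forall (closedBall_subset_closedBall hrr'))

/-- **Dyadic shells**: if `|ΔP(w)| ≤ θ_i/‖w‖²` whenever `‖w‖ ≥ 2^i`, then
`∫_{|w|≤2^K} |ΔP| ≤ ∫_{|w|≤1} |ΔP| + 8|B₁| Σ_{i<K} θ_i 2^i` (on the shell `2^i ≤ ‖w‖ ≤ 2^{i+1}`, `|ΔP| ≤ θ_i 4^{−i}` and
the shell has volume `≤ 8^{i+1}|B₁|`). [folklore] -/
theorem setIntegral_abs_laplacian_two_pow_le {P : EuclideanSpace ℝ (Fin 3) → ℝ} (hP : ContDiff ℝ 2 P)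
    {θ : ℕ → ℝ} (hθ : ∀ i, 0 ≤ θ i)
    (hΔ : ∀ (i : ℕ) (w : EuclideanSpace ℝ (Fin 3)), (2 : ℝ) ^ i ≤ ‖w‖ → |(Δ P) w| ≤ θ i / ‖w‖ ^ 2) :
    ∀ K : ℕ, ∫ w in closedBall (0 : EuclideanSpace ℝ (Fin 3)) (2 ^ K), |(Δ P) w| ≤
      (∫ w in closedBall (0 : EuclideanSpace ℝ (Fin 3)) 1, |(Δ P) w|) +
        8 * (volume (ball (0 : EuclideanSpace ℝ (Fin 3)) 1)).toReal * ∑ i ∈ Finset.range K, θ i * 2 ^ i := by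
  have hΔc : Continuous fun w : EuclideanSpace ℝ (Fin 3) => |(Δ P) w| :=
    (Literature.Analysis.FluidPDE.continuous_laplacian hP).abs
  set V₁ : ℝ := (volume (ball (0 : EuclideanSpace ℝ (Fin 3)) 1)).toReal with hV₁
  intro K
  induction K with
  | zero => simp
  | succ K ih =>
    -- pointwise: `1_{B_{K+1}} |ΔP| ≤ 1_{B_K} |ΔP| + θ_K 4^{-K} 1_{B_{K+1}}`
    set BK := closedBall (0 : EuclideanSpace ℝ (Fin 3)) (2 ^ K) with hBK
    set BK1 := closedBall (0 : EuclideanSpace ℝ (Fin 3)) (2 ^ (K + 1)) with hBK1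
    have hpt : (fun w => BK1.indicator (fun w => |(Δ P) w|) w) ≤
        fun w => BK.indicator (fun w => |(Δ P) w|) w + BK1.indicator (fun _ => θ K / 4 ^ K) w := by
      intro w
      by_cases hw1 : w ∈ BK1
      · by_cases hw : w ∈ BK
        · simp only [Set.indicator_of_mem hw1, Set.indicator_of_mem hw]
          have : 0 ≤ θ K / 4 ^ K := by have := hθ K; positivity
          linarith
        · simp only [Set.indicator_of_mem hw1, Set.indicator_of_notMem hw, zero_add]
          rw [hBK, mem_closedBall_zero_iff, not_le] at hw
          have hwpos : 0 < ‖w‖ := (pow_pos two_pos K).trans hw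
          refine (hΔ K w hw.le).trans ?_
          rw [div_le_div_iff₀ (pow_pos hwpos 2) (pow_pos (by norm_num) K)]
          have h4 : (4 : ℝ) ^ K = (2 ^ K) ^ 2 := by rw [← pow_mul, mul_comm, pow_mul]; norm_num
          rw [h4]
          have := pow_le_pow_left₀ (pow_pos two_pos K).le hw.le 2
          exact mul_le_mul_of_nonneg_left this (hθ K)
      · have hw : w ∉ BK := fun h => hw1 (closedBall_subset_closedBall
          (pow_le_pow_right₀ one_le_two (Nat.le_succ K)) h)
        simp only [Set.indicator_of_notMem hw1, Set.indicator_of_notMem hw, add_zero, le_refl]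
    have hint1 : Integrable fun w => BK1.indicator (fun w => |(Δ P) w|) w :=
      (hΔc.continuousOn.integrableOn_compact (isCompact_closedBall _ _)).integrable_indicator
        measurableSet_closedBall
    have hint2 : Integrable fun w => BK.indicator (fun w => |(Δ P) w|) w :=
      (hΔc.continuousOn.integrableOn_compact (isCompact_closedBall _ _)).integrable_indicator
        measurableSet_closedBall
    have hint3 : Integrable fun w => BK1.indicator (fun _ => θ K / 4 ^ K) w :=
      (integrableOn_const (measure_closedBall_lt_top.ne)).integrable_indicator measurableSet_closedBall
    have hvol : ∫ w, BK1.indicator (fun _ => θ K / 4 ^ K) w = θ K / 4 ^ K * ((2 ^ (K + 1)) ^ 3 * V₁) := by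
      rw [integral_indicator measurableSet_closedBall, setIntegral_const, smul_eq_mul,
        show volume.real (closedBall (0 : EuclideanSpace ℝ (Fin 3)) (2 ^ (K + 1))) =
          (volume (closedBall (0 : EuclideanSpace ℝ (Fin 3)) (2 ^ (K + 1)))).toReal from rfl,
        volumeReal_closedBall_eq (by positivity), hV₁]
      ring
    calc ∫ w in BK1, |(Δ P) w| = ∫ w, BK1.indicator (fun w => |(Δ P) w|) w :=
          (integral_indicator measurableSet_closedBall).symm
      _ ≤ ∫ w, BK.indicator (fun w => |(Δ P) w|) w + BK1.indicator (fun _ => θ K / 4 ^ K) w :=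
          integral_mono hint1 (hint2.add hint3) hpt
      _ = (∫ w in BK, |(Δ P) w|) + θ K / 4 ^ K * ((2 ^ (K + 1)) ^ 3 * V₁) := by
          rw [integral_add hint2 hint3, integral_indicator measurableSet_closedBall, hvol]
      _ ≤ (∫ w in closedBall (0 : EuclideanSpace ℝ (Fin 3)) 1, |(Δ P) w|) +
            8 * V₁ * ∑ i ∈ Finset.range K, θ i * 2 ^ i + θ K / 4 ^ K * ((2 ^ (K + 1)) ^ 3 * V₁) := by
          linarith [ih]
      _ = (∫ w in closedBall (0 : EuclideanSpace ℝ (Fin 3)) 1, |(Δ P) w|) +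
            8 * V₁ * ∑ i ∈ Finset.range (K + 1), θ i * 2 ^ i := by
          rw [Finset.sum_range_succ]
          have h8 : θ K / 4 ^ K * ((2 ^ (K + 1)) ^ 3 * V₁) = 8 * V₁ * (θ K * 2 ^ K) := by
            have h4 : (4 : ℝ) ^ K = 2 ^ K * 2 ^ K := by rw [← mul_pow]; norm_num
            rw [h4, pow_succ]
            field_simp
            ring
          rw [h8]
          ring

/-! ## §2 The small-scale shell step under a far-field bound -/

/-- **Small-scale step, dyadic currency**: if `8c ≤ ‖y‖` and `|ΔP(w)| ≤ τ/‖w‖²` for `‖w‖ ≥ ‖y‖/2`, then the centred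
shell step obeys `|M_c − M_{2c}| ≤ 512·C_Γ·|B₁|·τ·‖e‖·c/‖y‖²` (the ball `|z| ≤ 4c` around `y` stays in `‖w‖ ≥ ‖y‖/2`,
where `|ΔP| ≤ 4τ/‖y‖²`). [folklore] -/
theorem abs_shellStep_le_dyadic_small {C : ℝ} (hC0 : 0 ≤ C)
    (hC : ∀ w : EuclideanSpace ℝ (Fin 3), ‖w‖ ^ 2 * ‖fderiv ℝ (newtonFar 1 2) w‖ ≤ C)
    {P : EuclideanSpace ℝ (Fin 3) → ℝ} (hP : ContDiff ℝ ∞ P) {τ : ℝ} (hτ : 0 ≤ τ)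
    (y e : EuclideanSpace ℝ (Fin 3))
    (hΔ : ∀ w : EuclideanSpace ℝ (Fin 3), ‖y‖ / 2 ≤ ‖w‖ → |(Δ P) w| ≤ τ / ‖w‖ ^ 2)
    {c : ℝ} (hc : 0 < c) (hcy : 8 * c ≤ ‖y‖) :
    |(∫ z, newtonFarLaplacian c (2 * c) z * fderiv ℝ P (y + z) e) -
        (∫ z, newtonFarLaplacian (2 * c) (4 * c) z * fderiv ℝ P (y + z) e)| ≤
      512 * C * (volume (ball (0 : EuclideanSpace ℝ (Fin 3)) 1)).toReal * τ * ‖e‖ * (c / ‖y‖ ^ 2) := by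
  have hypos : 0 < ‖y‖ := by linarith
  have h1 := abs_shellStep_le hC0 hC hP y e hc
  -- the ball integral
  have hbound : ∀ z ∈ closedBall (0 : EuclideanSpace ℝ (Fin 3)) (4 * c),
      ‖|(Δ P) (y + z)|‖ ≤ 4 * τ / ‖y‖ ^ 2 := by
    intro z hz
    rw [mem_closedBall_zero_iff] at hz
    rw [Real.norm_eq_abs, abs_abs]
    have hyz : ‖y‖ / 2 ≤ ‖y + z‖ := by
      have h' : ‖y‖ ≤ ‖y + z‖ + ‖z‖ := by
        have := norm_add_le (y + z) (-z); simp only [add_neg_cancel_right, norm_neg] at this; exact this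
      linarith
    have hyzpos : 0 < ‖y + z‖ := by linarith
    refine (hΔ (y + z) hyz).trans ?_
    rw [div_le_div_iff₀ (pow_pos hyzpos 2) (pow_pos hypos 2)]
    nlinarith [pow_le_pow_left₀ (by positivity : 0 ≤ ‖y‖ / 2) hyz 2]
  have h2 := norm_setIntegral_le_of_norm_le_const
    (measure_closedBall_lt_top : volume (closedBall (0 : EuclideanSpace ℝ (Fin 3)) (4 * c)) < ⊤) hbound
  rw [Real.norm_eq_abs] at h2
  have h2' := (le_abs_self _).trans h2
  rw [show volume.real (closedBall (0 : EuclideanSpace ℝ (Fin 3)) (4 * c)) =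
      (volume (closedBall (0 : EuclideanSpace ℝ (Fin 3)) (4 * c))).toReal from rfl,
    volumeReal_closedBall_eq (by positivity : (0 : ℝ) ≤ 4 * c)] at h2'
  have hpos : 0 ≤ 2 * C * ‖e‖ / c ^ 2 := by positivity
  refine h1.trans ((mul_le_mul_of_nonneg_left h2' hpos).trans (le_of_eq ?_))
  field_simp
  ring

/-! ## §3 Two finite sums -/

/-- `Σ_{j<n} (1/2)^j ≤ 2` and `Σ_{j<n} (1/4)^j ≤ 4/3`. -/
theorem sum_range_half_pow_le (n : ℕ) :
    ∑ j ∈ Finset.range n, (1 / 2 : ℝ) ^ j ≤ 2 ∧ ∑ j ∈ Finset.range n, (1 / 4 : ℝ) ^ j ≤ 4 / 3 := by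
  constructor
  · have h := geom_sum_Ico_le_of_lt_one (x := (1 / 2 : ℝ)) (m := 0) (n := n) (by norm_num) (by norm_num)
    rw [← Finset.range_eq_Ico] at h
    refine h.trans (le_of_eq ?_)
    norm_num
  · have h := geom_sum_Ico_le_of_lt_one (x := (1 / 4 : ℝ)) (m := 0) (n := n) (by norm_num) (by norm_num)
    rw [← Finset.range_eq_Ico] at h
    refine h.trans (le_of_eq ?_)
    norm_num

/-- **Weighted double sum**: for `θ_i ≥ 0`, `Σ_{k<n} 2^{−k} Σ_{i≤k} θ_i 2^i ≤ 2 Σ_{i<n} θ_i` (each `θ_i` is counted with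
the geometric weight `Σ_{k≥i} 2^{i−k} ≤ 2`; proved through the exact invariant `Σ_{i<n} θ_i (2 − 2^{i+1}/2^n)`). -/
theorem sum_range_weighted_le_two_mul {θ : ℕ → ℝ} (hθ : ∀ i, 0 ≤ θ i) (n : ℕ) :
    ∑ k ∈ Finset.range n, (∑ i ∈ Finset.range (k + 1), θ i * 2 ^ i) / 2 ^ k ≤
      2 * ∑ i ∈ Finset.range n, θ i := by
  have key : ∀ n : ℕ, ∑ k ∈ Finset.range n, (∑ i ∈ Finset.range (k + 1), θ i * 2 ^ i) / 2 ^ k =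
      ∑ i ∈ Finset.range n, θ i * (2 - 2 ^ (i + 1) / 2 ^ n) := by
    intro n
    induction n with
    | zero => simp
    | succ n ih =>
      rw [Finset.sum_range_succ, ih, Finset.sum_range_succ (fun i => θ i * (2 - 2 ^ (i + 1) / 2 ^ (n + 1))),
        Finset.sum_range_succ, add_div, Finset.sum_div]
      have h2n : (2 : ℝ) ^ (n + 1) ≠ 0 := pow_ne_zero _ two_ne_zero
      have hlast : θ n * 2 ^ n / 2 ^ n = θ n * (2 - 2 ^ (n + 1) / 2 ^ (n + 1)) := by
        rw [div_self h2n, mul_div_assoc, div_self (pow_ne_zero _ two_ne_zero)]; ring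
      rw [hlast, ← add_assoc, ← Finset.sum_add_distrib]
      congr 1
      refine Finset.sum_congr rfl fun i _ => ?_
      rw [pow_succ, pow_succ]
      field_simp
      ring
  rw [key n, Finset.mul_sum]
  refine Finset.sum_le_sum fun i _ => ?_
  have h : 0 ≤ 2 ^ (i + 1) / (2 : ℝ) ^ n := by positivity
  nlinarith [hθ i]

end TypeIRate

end Summit.NavierStokesRegularity.NavierStokesRegularity.Theorems.CoriolisHead

end
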